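import Summits.Ventures.HodgeRepro2.T7SupportKappaCartan

/-!
# The multiplicative shift of the Cartan size on `SU(1,1)` (support, seat p1)

For `g = su11 a b`, `x = su11 a' b'` in `SU(1,1)` (`|a|² − |b|² = 1`), the `(0,0)`-entry of the product is
`a a' + b conj(b')`, so with the **shift constant** `s(x) := |a'| + |b'|` (`shiftConst`; `s(x) ≥ 1`,
`(|a'| − |b'|) s(x) = 1`):

  `|a(g)| / s(x) ≤ |a(g x)| ≤ |a(g)| · s(x)`   (`le_norm_mat_mul_zero_zero`, `norm_mat_mul_zero_zero_le`),

i.e. the Cartan size `κ = |a|²` (`T7SupportKappaCartan.kappa_eq_normSq`) is MULTIPLICATIVELY shifted by a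
right translation: `κ(g)/s(x)² ≤ κ(g x) ≤ κ(g) s(x)²` — the «multiplicative `hshift`» of L3-ARGUMENT §2g's size
bookkeeping (crit-2 l. 15135: an additive shift is false for `κ`). Also: right or left multiplication by the
rotation torus does not change `|a|` (`norm_mat_mul_rot_zero_zero`, `norm_mat_rot_mul_zero_zero`), and the inverse
has the same `|a|`, `|b|` and shift constant (`norm_mat_inv_zero_zero`, `norm_mat_inv_zero_one`, `shiftConst_inv`).
Consequence used for the line's ONE-vector test function: along the second-torus orbit
`γ h ρ_B(w) h⁻¹ = ((γ h) rot(w)) h⁻¹` the Cartan size stays within the factor `s(h)²` of `κ(γ) = |a(γ h)|²`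
(`le_norm_mat_conj_torus_zero_zero`).

Explicit model only; nothing about the adelic group, the global invariant, or any period.
Blind lane: Mathlib + the HodgeRepro2 prefix only; no sorry; axioms ⊆ {propext, Classical.choice, Quot.sound}.
-/

namespace Summit.Ventures.HodgeRepro2.T7SupportCartanShift

open Matrix
open T5SU11Unimodular T5SU11Fibration T5BergmanCoefficient T7SupportKappaCartan

/-- the second row of `g ∈ SU(1,1)` is the conjugate of the first, reversed: `g 1 0 = conj (g 0 1)` -/
theorem mat_one_zero (g : SU11) : mat g 1 0 = (starRingEnd ℂ) (mat g 0 1) := by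
  have h := coe_eq_su11 g
  rw [show mat g 1 0 = T5PoincareDensity.su11 (mat g 0 0) (mat g 0 1) 1 0 from congrFun (congrFun h 1) 0]
  simp [T5PoincareDensity.su11]

/-- `g 1 1 = conj (g 0 0)` -/
theorem mat_one_one (g : SU11) : mat g 1 1 = (starRingEnd ℂ) (mat g 0 0) := by
  have h := coe_eq_su11 g
  rw [show mat g 1 1 = T5PoincareDensity.su11 (mat g 0 0) (mat g 0 1) 1 1 from congrFun (congrFun h 1) 1]
  simp [T5PoincareDensity.su11]

/-- the `(0,0)`-entry of a product: `a(g x) = a(g) a(x) + b(g) conj(b(x))` -/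
theorem mat_mul_zero_zero (g x : SU11) :
    mat (g * x) 0 0 = mat g 0 0 * mat x 0 0 + mat g 0 1 * (starRingEnd ℂ) (mat x 0 1) := by
  have e : mat (g * x) = mat g * mat x := rfl
  rw [e, Matrix.mul_apply, Fin.sum_univ_two, mat_one_zero]

/-- `|b(g)| ≤ |a(g)|` on `SU(1,1)` -/
theorem norm_mat_zero_one_le (g : SU11) : ‖mat g 0 1‖ ≤ ‖mat g 0 0‖ := by
  have h := T5SU11Fibration.normSq_sub_normSq g
  rw [Complex.normSq_eq_norm_sq, Complex.normSq_eq_norm_sq] at h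
  nlinarith [norm_nonneg (mat g 0 0), norm_nonneg (mat g 0 1)]

/-- `1 ≤ |a(g)|` -/
theorem one_le_norm_mat_zero_zero (g : SU11) : 1 ≤ ‖mat g 0 0‖ := by
  have h := T5SU11Fibration.normSq_sub_normSq g
  rw [Complex.normSq_eq_norm_sq, Complex.normSq_eq_norm_sq] at h
  nlinarith [norm_nonneg (mat g 0 0), norm_nonneg (mat g 0 1)]

/-- **the shift constant** `s(x) = |a(x)| + |b(x)|` -/
noncomputable def shiftConst (x : SU11) : ℝ := ‖mat x 0 0‖ + ‖mat x 0 1‖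

/-- `1 ≤ s(x)` -/
theorem one_le_shiftConst (x : SU11) : 1 ≤ shiftConst x := by
  unfold shiftConst
  linarith [one_le_norm_mat_zero_zero x, norm_nonneg (mat x 0 1)]

/-- `0 < s(x)` -/
theorem shiftConst_pos (x : SU11) : 0 < shiftConst x := lt_of_lt_of_le one_pos (one_le_shiftConst x)

/-- `(|a(x)| − |b(x)|) · s(x) = 1` -/
theorem sub_mul_shiftConst (x : SU11) : (‖mat x 0 0‖ - ‖mat x 0 1‖) * shiftConst x = 1 := by
  have h := T5SU11Fibration.normSq_sub_normSq x
  rw [Complex.normSq_eq_norm_sq, Complex.normSq_eq_norm_sq] at h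
  unfold shiftConst
  nlinarith

/-- `|a(x)| − |b(x)| = s(x)⁻¹` -/
theorem sub_eq_inv_shiftConst (x : SU11) : ‖mat x 0 0‖ - ‖mat x 0 1‖ = (shiftConst x)⁻¹ := by
  have h := sub_mul_shiftConst x
  have hs := (shiftConst_pos x).ne'
  calc ‖mat x 0 0‖ - ‖mat x 0 1‖ = (‖mat x 0 0‖ - ‖mat x 0 1‖) * shiftConst x * (shiftConst x)⁻¹ := by
        field_simp
    _ = (shiftConst x)⁻¹ := by rw [h, one_mul]

/-- **upper shift**: `|a(g x)| ≤ |a(g)| · s(x)` -/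
theorem norm_mat_mul_zero_zero_le (g x : SU11) : ‖mat (g * x) 0 0‖ ≤ ‖mat g 0 0‖ * shiftConst x := by
  rw [mat_mul_zero_zero]
  unfold shiftConst
  calc ‖mat g 0 0 * mat x 0 0 + mat g 0 1 * (starRingEnd ℂ) (mat x 0 1)‖
      ≤ ‖mat g 0 0 * mat x 0 0‖ + ‖mat g 0 1 * (starRingEnd ℂ) (mat x 0 1)‖ := norm_add_le _ _
    _ = ‖mat g 0 0‖ * ‖mat x 0 0‖ + ‖mat g 0 1‖ * ‖mat x 0 1‖ := by
        rw [norm_mul, norm_mul, Complex.norm_conj]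
    _ ≤ ‖mat g 0 0‖ * ‖mat x 0 0‖ + ‖mat g 0 0‖ * ‖mat x 0 1‖ := by
        gcongr
        exact norm_mat_zero_one_le g
    _ = ‖mat g 0 0‖ * (‖mat x 0 0‖ + ‖mat x 0 1‖) := by ring

/-- **lower shift**: `|a(g)| ≤ s(x) · |a(g x)|`, i.e. `|a(g x)| ≥ |a(g)| / s(x)` -/
theorem le_norm_mat_mul_zero_zero (g x : SU11) : ‖mat g 0 0‖ ≤ shiftConst x * ‖mat (g * x) 0 0‖ := by
  rw [mat_mul_zero_zero]
  have h1 : ‖mat g 0 0‖ * ‖mat x 0 0‖ - ‖mat g 0 1‖ * ‖mat x 0 1‖ ≤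
      ‖mat g 0 0 * mat x 0 0 + mat g 0 1 * (starRingEnd ℂ) (mat x 0 1)‖ := by
    have := norm_sub_norm_le (mat g 0 0 * mat x 0 0) (-(mat g 0 1 * (starRingEnd ℂ) (mat x 0 1)))
    rw [sub_neg_eq_add, norm_neg, norm_mul, norm_mul, Complex.norm_conj] at this
    exact this
  have h2 : ‖mat g 0 0‖ * (‖mat x 0 0‖ - ‖mat x 0 1‖) ≤
      ‖mat g 0 0‖ * ‖mat x 0 0‖ - ‖mat g 0 1‖ * ‖mat x 0 1‖ := by
    nlinarith [norm_mat_zero_one_le g, norm_nonneg (mat x 0 1)]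
  have h3 : ‖mat g 0 0‖ * (‖mat x 0 0‖ - ‖mat x 0 1‖) ≤
      ‖mat g 0 0 * mat x 0 0 + mat g 0 1 * (starRingEnd ℂ) (mat x 0 1)‖ := h2.trans h1
  rw [sub_eq_inv_shiftConst] at h3
  have hs := shiftConst_pos x
  calc ‖mat g 0 0‖ = shiftConst x * (‖mat g 0 0‖ * (shiftConst x)⁻¹) := by
        field_simp
    _ ≤ shiftConst x * ‖mat g 0 0 * mat x 0 0 + mat g 0 1 * (starRingEnd ℂ) (mat x 0 1)‖ := by
        gcongr

/-- the matrix of `rot u` is `diag(u, conj u)` -/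
theorem mat_rot (u : Circle) : mat (rot u) = T5PoincareDensity.su11 (u : ℂ) 0 := rfl

/-- right rotation does not change `|a|`: `|a(g · rot u)| = |a(g)|` -/
theorem norm_mat_mul_rot_zero_zero (g : SU11) (u : Circle) : ‖mat (g * rot u) 0 0‖ = ‖mat g 0 0‖ := by
  rw [mat_mul_zero_zero, mat_rot]
  simp [T5PoincareDensity.su11]

/-- left rotation does not change `|a|`: `|a(rot u · g)| = |a(g)|` -/
theorem norm_mat_rot_mul_zero_zero (u : Circle) (g : SU11) : ‖mat (rot u * g) 0 0‖ = ‖mat g 0 0‖ := by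
  rw [mat_mul_zero_zero, mat_rot]
  simp [T5PoincareDensity.su11]

/-- `|a(g⁻¹)| = |a(g)|` -/
theorem norm_mat_inv_zero_zero (g : SU11) : ‖mat g⁻¹ 0 0‖ = ‖mat g 0 0‖ := by
  rw [mat_inv]
  simp [T5PoincareDensity.su11]

/-- `|b(g⁻¹)| = |b(g)|` -/
theorem norm_mat_inv_zero_one (g : SU11) : ‖mat g⁻¹ 0 1‖ = ‖mat g 0 1‖ := by
  rw [mat_inv]
  simp [T5PoincareDensity.su11]

/-- `s(g⁻¹) = s(g)` -/
theorem shiftConst_inv (g : SU11) : shiftConst g⁻¹ = shiftConst g := by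
  unfold shiftConst
  rw [norm_mat_inv_zero_zero, norm_mat_inv_zero_one]

/-- **along the second-torus orbit the Cartan size stays within the shift constant of `h`**:
`|a(γ h)| ≤ s(h) · |a(γ h rot(w) h⁻¹)|` (so `|a(γ (h rot(w) h⁻¹))|^{−k} ≤ s(h)^k |a(γ h)|^{−k}`) -/
theorem le_norm_mat_conj_torus_zero_zero (γ h : SU11) (w : Circle) :
    ‖mat (γ * h) 0 0‖ ≤ shiftConst h * ‖mat (γ * (h * rot w * h⁻¹)) 0 0‖ := by
  have e : γ * (h * rot w * h⁻¹) = (γ * h * rot w) * h⁻¹ := by group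
  rw [e, ← shiftConst_inv h, ← norm_mat_mul_rot_zero_zero (γ * h) w]
  exact le_norm_mat_mul_zero_zero (γ * h * rot w) h⁻¹

/-- the same, in the form `|a(γ h rot(w) h⁻¹)|⁻¹ ≤ s(h) · |a(γ h)|⁻¹` -/
theorem inv_norm_mat_conj_torus_zero_zero_le (γ h : SU11) (w : Circle) :
    ‖mat (γ * (h * rot w * h⁻¹)) 0 0‖⁻¹ ≤ shiftConst h * ‖mat (γ * h) 0 0‖⁻¹ := by
  have ha : 0 < ‖mat (γ * h) 0 0‖ := lt_of_lt_of_le one_pos (one_le_norm_mat_zero_zero _)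
  have hs := shiftConst_pos h
  have h1 := le_norm_mat_conj_torus_zero_zero γ h w
  have h2 : ‖mat (γ * h) 0 0‖ / shiftConst h ≤ ‖mat (γ * (h * rot w * h⁻¹)) 0 0‖ := by
    rw [div_le_iff₀ hs, mul_comm]
    exact h1
  calc ‖mat (γ * (h * rot w * h⁻¹)) 0 0‖⁻¹ ≤ (‖mat (γ * h) 0 0‖ / shiftConst h)⁻¹ :=
        inv_anti₀ (div_pos ha hs) h2
    _ = shiftConst h * ‖mat (γ * h) 0 0‖⁻¹ := by rw [inv_div, div_eq_mul_inv]

end Summit.Ventures.HodgeRepro2.T7SupportCartanShift
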